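import Summits.HubbardSuperconductivity.HubbardSuperconductivity.Theorems.AnisotropyChordTransferFibre3Hole2Check

/-!
# Route `AnisotropyChord` / H0 rotor rung: HOLE₂ per-`L` certificates — the FAST kernel checker (separable Green table, `O(L³)`)

Second computable layer of the per-`L` HOLE₂(.75) certificates (`…Fibre3Hole2Check`).  The Green's function
`G̃_g(r₁,r₂) = (1/V) Σ_{k≠0} cos(2π(k₁r₁+k₂r₂)/L)/(ε(k) − g)` is SEPARABLE after the odd part drops out
(`k₂ ↦ −k₂` leaves `ε` invariant and flips `sin`):  `G̃_g(r₁,r₂) = (1/V) Σ_{k₁} cos(2πk₁r₁/L) · C(k₁,r₂)`,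
`C(k₁,r₂) = Σ_{k₂, (k₁,k₂)≠0} cos(2πk₂r₂/L)/(ε(k₁,k₂) − g)`.  So the WHOLE table `G̃_g(r)`, `r ∈ (ℤ/L)²`, costs `2L³` interval
operations (`cTab`, `gTab`) instead of `L²` per value, and every pair `(0, s)` then only reads its `10 × 10` Green matrix off the table
(`gMatT`); the rest of the pipeline (`x2Mat`, `s2Mat`, `kMat`, `k2Mat`, `psdCheck` of `…Fibre3Hole2Check`) is unchanged except that the
charge map is the cheaper fixed-point Gauss–Jordan inverse `eMatZ` (any `E` is admissible), so the
generic soundness theorems of `…Fibre3Hole2Sound/Agg/Cert` apply verbatim once the table is shown to enclose `Re G̃` (`…Fibre3Hole2FastSound`).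
`checkRepsT L reps` runs the parameter checks, builds the tables once, and tests every listed separation — ONE `decide` per `L`
for `L ≲ 12` (e.g. `L = 9`: 14 classes in ≈ 1 min of kernel time), a few for larger `L`.
Prover seat `hubbard-h0-rotor-p3` g3; helper for stmt-HubbardSuperconductivity-19089 (`--supports`, helper class).
WHAT THIS IS NOT: nothing here proves superconductivity in the Hubbard model (rotor TARGET as worded stays FALSE, g15 verdict);
computable half of per-`L` certificates for ONE input (HOLE₂) of ONE conditional reduction (rung 19089). Tree imports only; no sorry.
-/

set_option linter.dupNamespace false
set_option autoImplicit false

namespace Summit.HubbardSuperconductivity.HubbardSuperconductivity.Theorems.AnisotropyChord.Transfer.Fibre3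

namespace Hole2

/-! ## The inner table `C(k₁, r₂)` -/

/-- `C(k₁,r₂)` accumulated over `k₂ < n`: `Σ_{k₂ < n, (k₁,k₂) ≠ 0} cos(2πk₂r₂/L) · [1/(ε(k₁,k₂) − g)]`. [folklore] -/
def cRow (L : ℕ) (ct erow : List Iv) (k1 r2 : ℕ) : ℕ → Iv
  | 0 => (0, 0)
  | k2 + 1 =>
      if k1 = 0 ∧ k2 = 0 then cRow L ct erow k1 r2 k2
      else iadd (cRow L ct erow k1 r2 k2) (imul (getIv ct ((k2 * r2) % L)) (getIv erow k2))

/-- the table `C(k₁, r₂)`, row `k₁`, column `r₂`. [folklore] -/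
def cTab (L : ℕ) (ct : List Iv) (et : List (List Iv)) : List (List Iv) :=
  (List.range L).map fun k1 => (List.range L).map fun r2 => cRow L ct (et.getD k1 []) k1 r2 L

/-! ## The Green table `G̃(r₁, r₂)` -/

/-- `Σ_{k₁ < n} cos(2πk₁r₁/L) · C(k₁, r₂)`. [folklore] -/
def gOuter (L : ℕ) (ct : List Iv) (ctab : List (List Iv)) (r1 r2 : ℕ) : ℕ → Iv
  | 0 => (0, 0)
  | k1 + 1 => iadd (gOuter L ct ctab r1 r2 k1) (imul (getIv ct ((k1 * r1) % L)) (getIv (ctab.getD k1 []) r2))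

/-- enclosure of `G̃_g(r₁,r₂)` from the inner table. [folklore] -/
def greenIvT (L : ℕ) (ct : List Iv) (ctab : List (List Iv)) (r1 r2 : ℕ) : Iv :=
  idivn (gOuter L ct ctab r1 r2 L) ((L : ℤ) * L)

/-- the full Green table, row `r₁`, column `r₂`. [folklore] -/
def gTab (L : ℕ) (ct : List Iv) (ctab : List (List Iv)) : List (List Iv) :=
  (List.range L).map fun r1 => (List.range L).map fun r2 => greenIvT L ct ctab r1 r2

/-- the `10 × 10` interval Green matrix of the pair `(0, (s₁,s₂))` READ OFF a Green table. [folklore] -/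
def gMatT (L : ℕ) (gt : List (List Iv)) (s1 s2 : ℕ) : List (List Iv) :=
  (List.range 10).map fun p => (List.range 10).map fun q =>
    getIv (gt.getD (((slotPt L s1 s2 p).1 + (L - (slotPt L s1 s2 q).1)) % L) [])
      (((slotPt L s1 s2 p).2 + (L - (slotPt L s1 s2 q).2)) % L)

/-! ## A cheaper charge map: fixed-point Gauss–Jordan (any `E` is admissible, so no exactness is needed) -/

/-- one fixed-point Gauss–Jordan step (scale `D`): normalise row `c` by its pivot, clear column `c` elsewhere. [folklore] -/
def gjStepZ (M : List (List ℤ)) (c : ℕ) : List (List ℤ) :=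
  let rowc := M.getD c []
  let pv := rowc.getD c 0
  if pv = 0 then M else
    let rown := rowc.map fun x => x * D / pv
    (List.range M.length).map fun r =>
      if r = c then rown else
        let rowr := M.getD r []
        let f := rowr.getD c 0
        List.zipWith (fun a b => a - f * b / D) rowr rown

/-- partial pivoting: bring the row (at or below `c`) with the largest `|entry|` in column `c` into position `c`. [folklore] -/
def gjPivotZ (M : List (List ℤ)) (c : ℕ) : List (List ℤ) :=
  let n := M.length
  let best := (List.range n).foldl (fun b r =>
    if c ≤ r ∧ ((M.getD b []).getD c 0).natAbs < ((M.getD r []).getD c 0).natAbs then r else b) c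
  if best = c then M else
    (List.range n).map fun i => if i = c then M.getD best [] else if i = best then M.getD c [] else M.getD i []

/-- fixed-point inverse (scale `D`) of a square fixed-point matrix (junk if singular — harmless). [folklore] -/
def gjInverseZ (A : List (List ℤ)) : List (List ℤ) :=
  let n := A.length
  let aug := (List.range n).map fun i => (A.getD i []) ++ (List.range n).map fun j => if i = j then D else 0
  let red := (List.range n).foldl (fun M c => gjStepZ (gjPivotZ M c) c) aug
  red.map fun row => row.drop n

/-- the integer charge map from the fixed-point inverse of the midpoint Green matrix on representative slots. [folklore] -/
def eMatZ (L : ℕ) (G : List (List Iv)) (s1 s2 : ℕ) : ℕ → ℕ → ℤ :=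
  let reps := repSlots L s1 s2
  let A : List (List ℤ) := reps.map fun p => reps.map fun q => mid (getM G p q)
  let Ainv := gjInverseZ A
  fun p q =>
    if (repOf L s1 s2 p == p) && (repOf L s1 s2 q == q) then
      (Ainv.getD (repIdx L s1 s2 p) []).getD (repIdx L s1 s2 q) 0
    else 0

/-! ## Cheaper bookkeeping with the same integer values: factorised `S2`, aggregation over the free slots only -/

/-- `(X2·E)` tabulated. [folklore] -/
def xeTab (X2 E : ℕ → ℕ → ℤ) : ℕ → ℕ → ℤ := tab 10 fun a q => ∑ b ∈ Finset.range 10, X2 a b * E b q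

/-- `S2 = 2D²(E + Eᵀ) − Eᵀ·(X2·E) − D³·1` — equal to `s2Mat E X2` on the range (`s2MatF_eq` in `…Hole2FastSound`),
`2·10³` products instead of `10⁴`. [folklore] -/
def s2MatF (E X2 : ℕ → ℕ → ℤ) (p q : ℕ) : ℤ :=
  2 * D * D * (E p q + E q p) - (∑ a ∈ Finset.range 10, E a p * xeTab X2 E a q) - (if p = q then D * D * D else 0)

/-- the live slots represented by `p`. [folklore] -/
def freeOf (L s1 s2 p : ℕ) : Finset ℕ :=
  (Finset.range 10).filter fun a => repOf L s1 s2 a = p ∧ isHole L s1 s2 a = false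

/-- aggregation over the free slots only — equal to `kMat` (`kMatF_eq` in `…Hole2FastSound`). [folklore] -/
def kMatF (L s1 s2 : ℕ) (S2 : ℕ → ℕ → ℤ) (p q : ℕ) : ℤ :=
  ∑ a ∈ freeOf L s1 s2 p, ∑ b ∈ freeOf L s1 s2 q, S2 a b

/-! ## The checks -/

/-- the per-pair test on a given interval Green matrix `G`: `s ≢ 0` and `K2 ⪰ 0`, with the charge map `eMatZ` and the factorised
bookkeeping (same integers as `kMat`/`s2Mat`). [folklore] -/
def checkPairG (L : ℕ) (G : List (List Iv)) (s1 s2 : ℕ) : Bool :=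
  decide (¬ (s1 % L = 0 ∧ s2 % L = 0)) &&
    psdCheck 10 (k2Mat (kMatF L s1 s2 (tab 10 (s2MatF (eMatZ L G s1 s2) (x2Mat G)))))

/-- the Green table at `L` for the certified constant `g_L` (shared tables built here once). [folklore] -/
def gTabL (L : ℕ) : List (List Iv) :=
  gTab L (cosTab L) (cTab L (cosTab L) (einvTab L (cosTab L) (gFix L)))

/-- ★ FAST CHECK of a list of separations: parameters, one Green table, then every pair. [folklore] -/
def checkRepsT (L : ℕ) (reps : List (ℕ × ℕ)) : Bool :=
  let gt := gTabL L
  checkParams L && reps.all fun s => checkPairG L (gMatT L gt s.1 s.2) s.1 s.2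

end Hole2

end Summit.HubbardSuperconductivity.HubbardSuperconductivity.Theorems.AnisotropyChord.Transfer.Fibre3
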